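import Literature.MathematicalPhysics.QuantumFieldTheory.Balaban1983to89.B8Thm4ExistsConcreteGamma

/-!
# `Balaban1983to89.B8Thm4ExistsAtGamma` — [Balaban1985RegularSpaces] THEOREM 4 (p. 88), EXISTENCE HALF PER DATUM with the three socket BODIES at the
# datum, EDITION γ (print's box law «box ⊂ Ω_{j−1}» for the (1.59) datum class — inner AND crossing bonds at every level; the datum's (1.35) in print's class)

statement-level skeleton of published theorems with citation tags; proofs where landed; nothing here is a claim about the
Yang–Mills mass gap

PDF held: `paper:balaban1985-cmp99-regular-spaces-gauge-fixing` (journal page = PDF page + 74); Thm 4 p. 88, (1.29)–(1.38) pp. 81–82, (1.55)–(1.62) pp. 86–87,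
(1.66) p. 87, Prop. 5 pp. 94–95, p. 77 (bond convention) — re-read at typing.

CITATION HEADER (lean-in-tree rule).  Cell `pub-ymgap` (HUMAN RULING D-0062, Track A), DAG node N05 = [B8], seat `pub-ymgap-dag-n05-e` g10 (R141 (C) row s3b —
the FLAT line of Proposition 6's cube road, edition γ).  WHY THIS FILE.  The per-datum existence driver of this seat's flat line, `B8Thm4ExistsAtBdryBeta.
thm4Exists_concrete_at_bdryβ` (g8, p552060), reads the (1.59) datum over a class `Λb` under the law «fine box ⊂ Ω_j» — at nested members that class has NO
crossing bond at levels `j ≥ 1` and the shell gauge modes make every β-edition (1.59) clause VACUOUS there (dag-n05-c `B8Ineq159FlatShellModeVacuity`, p572834).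
EDITION γ (dag-lead DEDUP-349; this seat's driver `B8Eq142KLevelLocalGamma` p580875 ∕ `B8Thm4KLevelGamma` p581447 ∕ `B8Thm4ExistsConcreteGamma` p584093) reads
print's class ((1.31) p. 82 ∕ [B6] (2.3): «at least one end-point in Λ_j», crossing contours in `Λ_{j−1}`) under the box law «box ⊂ Ω_{j−1}» and asks the
datum's (1.35) in the same guard.  THIS FILE is the γ twin of the per-datum driver: ★ `thm4Exists_concrete_at_γ` — the statement of p552060 with `hbox` and the
(1.35) hypothesis re-guarded at `Ω (j − 1)`, the three socket BODIES (Prop. 5 base ∕ step, the two-line (1.59) body with the β-shaped index `Λb m j ∪ {level-0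
crossing bonds of Ω₀}` and the exterior-collar allowance `B_∂`) AT THE DATUM, threshold and conclusion byte-identical; proof = `B8Thm4ExistsConcreteGamma.
thm4Exists_concrete_uniform_γ`'s (windows `thm4_windows` + `thm4_windows_extra` + `thm4_windows_γ`, engine `thm4_exists_all_levels_supp_landau138_γ` at
`a := α₁ ≤ dLα₁`) with the sockets passed through instead of specialised.  What the flat line consumes at the Proposition-6 datum `(1, U₀″)` of a cube member,
where the three bodies are FLAT statements (background `1`).  Kind «kernel-checked proof», one theorem, no `def`.

HONEST SCOPE ∕ A6.  By-name re-run; nothing of [4] ∕ Props 3, 5 proved.  The three bodies are HYPOTHESES at the datum: Prop. 5's base ∕ step ([B8] Prop. 5 p. 94,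
the N05 Prop.-5 lane; on the flat line supplied from dag-n05-c's REAL letter families), and the two-line (1.59) body = [4] Thm 3.3 with exterior data over the
SUPPLIED class — print's (1.59) when `Λb` is print's class (dag-n05-c `cubeLamBP` ∕ dag-n06-b `cubeLamBP'` at the cube member; named there
`Ineq159FlatCubeMemberPrinted`, OPEN in the tree), vacuous over a «box ⊂ Ω_j» class at nested members (p572834) — no satisfiability claim is made here; `B_∂`,
`4B_∂ ≤ (dL − 1)B₀`, `hlay` displayed.  Count-neutral; N05 NOT discharged; one finite `𝕋⁴` programme at fixed `ε`, Bałaban as printed; nothing continuum ∕ ℝ⁴ ∕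
OS ∕ mass-gap ∕ Clay.  No `sorry`, no `def`, no `instance`, no `notation`.  Unit `pub-ymgap-dag-n05-e` (g10), 2026-08-28.

RELATED IN THE TREE, NOT DUPLICATED: `B8Thm4ExistsConcreteGamma.thm4Exists_concrete_uniform_γ` (sockets UNIFORM in the background, one threshold — the junction
road's shape; USED for its windows only), `B8Thm4ExistsAtBdryBeta.thm4Exists_concrete_at_bdryβ` (edition β, law «box ⊂ Ω_j»), `B8Thm4KLevelGamma.
thm4_exists_all_levels_supp_landau138_γ` (the engine, USED).
-/

noncomputable section

open NormedSpace

namespace Literature.MathematicalPhysics.QuantumFieldTheory.Balaban1983to89.B8Thm4ExistsAtGamma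

open Complex (I)
open MatrixLog B7Prop1Explicit B7Prop2Explicit B7Prop1Local B7Eq92Concrete
open B7Prop2Explicit (C0 c2')
open B7Prop3Flat (c3)
open B8Ineq132 (covDerivFwd InAk BondTouches)
open B8Eq119TwistedAxial (Restr129 InAx)
open B8Eq184Proof (gaugeExp cfgExp)
open B8Lemma1NonAbelian (mulCfg)
open B8Eq140Level (SideTouches)
open B8Eq146AExpansion (iEta)
open B7Prop4GeneralLevels (logCovIter linCovIter)
open B8Eq155JBound (Jcur wsup)
open B8ScaledSupNorm (bondNorm msup)
open B8Thm2LogB (blockTop)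
open B8Ineq130 (tlo thi)
open B8Eq138LandauZd (IsLandau138W logCfg)
open B8Prop3GaugeFixedKLevel (eq_mgauge_inv_of_mgauge_eq mem_unitaryUnits_of_mgauge_eq logField_spec)
open B8Thm4KLevelGamma (thm4_exists_all_levels_supp_landau138_γ)
open B8Thm4Windows (thm4_windows thm4_windows_extra)
open B8Thm4ExistsConcreteGamma (thm4_windows_γ)
open B9SupplySockB9P3ZdBeta (CrossB)

-- `Site` alone could resolve to the torus sites of `Setup.lean`; re-export the `ℤ^d` sites of `B7Prop1Explicit`.
export B7Prop1Explicit (Site)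

variable {d : ℕ}

variable {𝔸 : Type*} [CStarAlgebra 𝔸] [Nontrivial 𝔸]

/-- ★ **THEOREM 4 (p. 88), EXISTENCE HALF, IN THE LEAF's QUANTIFIER SHAPE, THREE SOCKET BODIES AT THE DATUM, EDITION γ** — `B8Thm4ExistsAtBdryBeta.
thm4Exists_concrete_at_bdryβ` (p552060) with the datum class `Λb` under PRINT's box law «box ⊂ Ω_{j−1}» (`hbox`; (1.31) p. 82: «all sites of the contours
Γ_{b₋,x} belong to Λ_{j−1}»), the class law `hclass` (inner ∕ crossing ∕ mirrored-crossing bonds w.r.t. the restriction tower `Λs m`), the boundary-layer law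
`hlay`, and the datum's (1.35) asked in print's class (every level-`j` bond whose box lies in `Ω_{j−1}`); the three socket BODIES — Proposition 5's fixed point at
the base level and at every intermediate level, and the two-line (1.59) body of Theorem 4's frame with the β-shaped averaging index `Λb m j ∪ {level-0 crossing
bonds of Ω₀}` and the exterior-collar allowance `B_∂` — are hypotheses AT THIS DATUM `(U₀, U′)`; one threshold `c₁(d, L, B₀, B₀′)` before the data; conclusion
byte-identical with p552060: a unitary `u`, `= 1` off `Ω₀`, (1.29) w.r.t. `Λs k`, the Landau gauge (1.38) of `U′^{u⁻¹}` (`k ≥ 1`) and the (1.62)-shape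
`Lʲη|(1∕iη) log U′^{u⁻¹}| ≤ 5dLB₀(α₀+α₁)` on the sides touching `Ω_j`.  Engine: `B8Thm4KLevelGamma.thm4_exists_all_levels_supp_landau138_γ` at `a := α₁ ≤ dLα₁`;
windows `thm4_windows` ∕ `thm4_windows_extra` ∕ `thm4_windows_γ`.
[cite: Balaban1985RegularSpaces, Thm 4 p.88, (1.29) p.81, (1.31) p.82, (1.35) p.82, (1.38) p.82, (1.58)–(1.62) pp.86–87, (1.66) p.87, Prop. 5 (1.107)–(1.108) p.94, pp.94–95, p.77; Balaban1984PropagatorsII, (2.3) p.224] -/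
theorem thm4Exists_concrete_at_γ (hd2 : 2 ≤ d) {L : ℕ} (hL : 2 ≤ L)
    {B₀ B₀' Bbd : ℝ} (hB₀ : 0 < B₀) (hB₀' : 0 < B₀') (hB : 2 ≤ 5 * (d : ℝ) * L * B₀) (hBbd : 0 ≤ Bbd) (hBd : 4 * Bbd ≤ ((d : ℝ) * L - 1) * B₀) :
    ∃ c₁ : ℝ, 0 < c₁ ∧ ∀ (η : ℝ), 0 < η → ∀ (k : ℕ)
    (Ω : ℕ → Set (Site d)) (hΩ : ∀ j, Ω (j + 1) ⊆ Ω j) (Λs : ℕ → ℕ → Set (Site d)) (Λb : ℕ → ℕ → Set (Site d × Fin d))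
    -- PRINT's box law (edition γ): the locality box of a level-`j` datum bond lies in `Ω_{j−1}` ((1.31); level 0: `Ω₀`)
    (hbox : ∀ m, m ≤ k → ∀ j, j ≤ m → ∀ c ∈ Λb m j, ∀ x, InBox (loK L j c.1) (bondHiK L j c.1 c.2) x → x ∈ Ω (j - 1))
    (hclass : ∀ m, m ≤ k → ∀ j, j ≤ m → ∀ c ∈ Λb m j,
      (c.1 ∈ Λs m j ∧ c.1 + e c.2 ∈ Λs m j) ∨
      (∃ j', j = j' + 1 ∧ (∀ x, (L : ℤ) • c.1 ≤ x → x ≤ (L : ℤ) • c.1 + blockTop L → x ∈ Λs m j') ∧ c.1 + e c.2 ∈ Λs m j) ∨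
      (∃ j', j = j' + 1 ∧ c.1 ∈ Λs m j ∧ (∀ x, (L : ℤ) • (c.1 + e c.2) ≤ x → x ≤ (L : ℤ) • (c.1 + e c.2) + blockTop L → x ∈ Λs m j')))
    -- the boundary-layer law of the datum's region: a site of `Ω₀` with a sup-distance-1 neighbour outside lies in `Λs m 0`, `1 ≤ m ≤ k`
    (hlay : ∀ m, 1 ≤ m → m ≤ k → ∀ y z : Site d, y ∈ Ω 0 → z ∉ Ω 0 → (∀ i, y i - 1 ≤ z i ∧ z i ≤ y i + 1) → y ∈ Λs m 0),
      ∀ α₀ α₁ : ℝ, 0 < α₀ → 0 < α₁ → α₀ + α₁ ≤ c₁ →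
      ∀ U₀ U' : Site d → Fin d → 𝔸ˣ, (∀ x κ, U₀ x κ ∈ unitaryUnits 𝔸) → (∀ x κ, U' x κ ∈ unitaryUnits 𝔸) →
      InAk L k η α₀ Ω U₀ → InAk L k η α₀ Ω (mulCfg U' U₀) → (∀ m, m ≤ k → InAx L m (Λs m) U₀ (mulCfg U' U₀)) →
      -- (1.35) for the datum in PRINT's class: every level-`j` bond whose box lies in `Ω_{j−1}` (p. 77 «at least one end-point in Ω»)
      (∀ j, j ≤ k → ∀ (z : Site d) (μ : Fin d), (∀ x, InBox (loK L j z) (bondHiK L j z μ) x → x ∈ Ω (j - 1)) →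
        ‖(avgIter L (mulCfg U' U₀) j z μ : 𝔸) - (avgIter L U₀ j z μ : 𝔸)‖ ≤ α₁) →
      (∀ b ∈ {b : Site d × Fin d | SideTouches (Ω 0) b.1 b.2}, ‖((U' b.1 b.2 : 𝔸ˣ) : 𝔸) - 1‖ ≤ α₁) →
      -- Proposition 5's fixed point at the base level, over THIS datum
      ((∃ (v : Site d → 𝔸ˣ) (lam : Site d → 𝔸), (∀ x, v x ∈ unitaryUnits 𝔸) ∧ (∀ x, x ∉ Ω 0 → v x = 1) ∧
        (∀ j, j ≤ 1 → ∀ b ∈ {b : Site d × Fin d | SideTouches (Ω j) b.1 b.2}, (v b.1 : 𝔸) = ((gaugeExp lam b.1 : 𝔸ˣ) : 𝔸) ∧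
        (v (b.1 + e b.2) : 𝔸) = ((gaugeExp lam (b.1 + e b.2) : 𝔸ˣ) : 𝔸)) ∧
        (∀ j, j ≤ 1 → ∀ b ∈ {b : Site d × Fin d | SideTouches (Ω j) b.1 b.2},
        ‖lam b.1‖ ≤ (8 * B₀' * (5 * (d : ℝ) * L * B₀) * (α₀ + α₁)) ∧ ((L : ℝ) ^ j * η) * ‖covDerivFwd η U₀ b.2 lam b.1‖ ≤ (8 * B₀' * (5 * (d : ℝ) * L * B₀) * (α₀ + α₁))) ∧
        IsLandau138W L 1 η (Ω 0) (Λs 1) U₀ (mgauge U₀ v⁻¹ U') ∧ Restr129 L 1 (Λs 1) U₀ ((1 : Site d → 𝔸ˣ) * v))) →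
      -- Proposition 5's fixed point at every intermediate level, over THIS datum
      ((∀ m, 1 ≤ m → m < k → ∀ (u₁ : Site d → 𝔸ˣ) (U₁ : Site d → Fin d → 𝔸ˣ) (A : Site d → Fin d → 𝔸),
        (∀ x, u₁ x ∈ unitaryUnits 𝔸) → (∀ x, x ∉ Ω 0 → u₁ x = 1) → mgauge U₀ u₁ U₁ = U' → Restr129 L m (Λs m) U₀ u₁ →
        IsLandau138W L m η (Ω 0) (Λs m) U₀ U₁ →
        (∀ j, j ≤ m → ∀ b ∈ {b : Site d × Fin d | SideTouches (Ω j) b.1 b.2},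
        U₁ b.1 b.2 = cfgExp η A b.1 b.2 ∧ IsSelfAdjoint (A b.1 b.2) ∧ ‖A b.1 b.2‖ ≤ (5 * (d : ℝ) * L * B₀ * (α₀ + α₁)) * ((L : ℝ) ^ j * η)⁻¹) →
        ∃ (v : Site d → 𝔸ˣ) (lam : Site d → 𝔸), (∀ x, v x ∈ unitaryUnits 𝔸) ∧ (∀ x, x ∉ Ω 0 → v x = 1) ∧
        (∀ j, j ≤ m + 1 → ∀ b ∈ {b : Site d × Fin d | SideTouches (Ω j) b.1 b.2}, (v b.1 : 𝔸) = ((gaugeExp lam b.1 : 𝔸ˣ) : 𝔸) ∧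
        (v (b.1 + e b.2) : 𝔸) = ((gaugeExp lam (b.1 + e b.2) : 𝔸ˣ) : 𝔸)) ∧
        (∀ j, j ≤ m + 1 → ∀ b ∈ {b : Site d × Fin d | SideTouches (Ω j) b.1 b.2},
        ‖lam b.1‖ ≤ (8 * B₀' * (5 * (d : ℝ) * L * B₀) * (α₀ + α₁)) ∧ ((L : ℝ) ^ j * η) * ‖covDerivFwd η U₀ b.2 lam b.1‖ ≤ (8 * B₀' * (5 * (d : ℝ) * L * B₀) * (α₀ + α₁))) ∧
        IsLandau138W L (m + 1) η (Ω 0) (Λs (m + 1)) U₀ (mgauge U₀ v⁻¹ U₁) ∧ Restr129 L (m + 1) (Λs (m + 1)) U₀ (u₁ * v))) →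
      -- (1.59) for the fields gauge-related to THIS `U′` over THIS `U₀`
      ((∀ m, 1 ≤ m → m ≤ k → ∀ (u : Site d → 𝔸ˣ) (W : Site d → Fin d → 𝔸ˣ) (A' : Site d → Fin d → 𝔸),
        (∀ x, u x ∈ unitaryUnits 𝔸) → (∀ x, x ∉ Ω 0 → u x = 1) → mgauge U₀ u W = U' → Restr129 L m (Λs m) U₀ u →
        IsLandau138W L m η (Ω 0) (Λs m) U₀ W → (∀ y τ, IsSelfAdjoint (A' y τ)) →
        (∀ j, j ≤ m → ∀ y τ, SideTouches (Ω j) y τ →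
        W y τ = cfgExp η A' y τ ∧ ‖A' y τ‖ ≤ (2 * (L * (5 * (d : ℝ) * L * B₀ * (α₀ + α₁))) + 8 * (8 * B₀' * (5 * (d : ℝ) * L * B₀) * (α₀ + α₁))) * ((L : ℝ) ^ j * η)⁻¹) →
        (∀ y τ, (∀ j, j ≤ m → ¬ SideTouches (Ω j) y τ) → A' y τ = 0) →
        msup L m η (-(1 : ℝ)) (fun j (b : Site d × Fin d) => SideTouches (Ω j) b.1 b.2) (fun b => A' b.1 b.2)
        ≤ B₀ * (bondNorm L m η (-(3 : ℝ)) Ω (fun x μ => Jcur η U₀ A' μ x)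
        + wsup 1 (fun p : {p : ℕ × (Site d × Fin d) // p.1 ≤ m ∧ (p.2 ∈ Λb m p.1 ∨ (p.1 = 0 ∧ CrossB (Ω 0) p.2))} =>
        linCovIter L U₀ (iEta η A') p.1.1 p.1.2.1 p.1.2.2))
        + Bbd * msup L m η (-(1 : ℝ)) (fun j (b : Site d × Fin d) => j = 0 ∧ SideTouches (Ω 0) b.1 b.2 ∧ ¬ BondTouches (Ω 0) b.1 b.2)
            (fun b => A' b.1 b.2) ∧
        msup L m η (-(2 : ℝ)) (fun j (t : Fin d × Fin d × Site d) => SideTouches (Ω j) t.2.2 t.2.1)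
        (fun t => covDerivFwd η U₀ t.1 (fun z => A' z t.2.1) t.2.2)
        ≤ B₀ * (bondNorm L m η (-(3 : ℝ)) Ω (fun x μ => Jcur η U₀ A' μ x)
        + wsup 1 (fun p : {p : ℕ × (Site d × Fin d) // p.1 ≤ m ∧ (p.2 ∈ Λb m p.1 ∨ (p.1 = 0 ∧ CrossB (Ω 0) p.2))} =>
        linCovIter L U₀ (iEta η A') p.1.1 p.1.2.1 p.1.2.2))
        + Bbd * msup L m η (-(1 : ℝ)) (fun j (b : Site d × Fin d) => j = 0 ∧ SideTouches (Ω 0) b.1 b.2 ∧ ¬ BondTouches (Ω 0) b.1 b.2)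
            (fun b => A' b.1 b.2))) →
      ∃ u : Site d → 𝔸ˣ, (∀ x, u x ∈ unitaryUnits 𝔸) ∧ (∀ x, x ∉ Ω 0 → u x = 1) ∧ Restr129 L k (Λs k) U₀ u ∧
        (1 ≤ k → IsLandau138W L k η (Ω 0) (Λs k) U₀ (mgauge U₀ u⁻¹ U')) ∧
        (∀ j, j ≤ k → ∀ b ∈ {b : Site d × Fin d | SideTouches (Ω j) b.1 b.2},
          mgauge U₀ u⁻¹ U' b.1 b.2 = cfgExp η (logCfg η (mgauge U₀ u⁻¹ U')) b.1 b.2 ∧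
            IsSelfAdjoint (logCfg η (mgauge U₀ u⁻¹ U') b.1 b.2) ∧
            ‖logCfg η (mgauge U₀ u⁻¹ U') b.1 b.2‖ ≤ (5 * (d : ℝ) * L * B₀ * (α₀ + α₁)) * ((L : ℝ) ^ j * η)⁻¹) := by
  have hL1 : 1 ≤ L := le_trans (by norm_num) hL
  have hd1 : 1 ≤ d := le_trans (by norm_num) hd2
  have hL' : (1 : ℝ) ≤ L := by exact_mod_cast hL1
  have hd' : (1 : ℝ) ≤ d := by exact_mod_cast hd1
  obtain ⟨c₁, hc₁, hw⟩ := thm4_windows hd1 hL1 hB₀ hB₀' hB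
  obtain ⟨c₂, hc₂, hw'⟩ := thm4_windows_extra (d := d) hL1
  obtain ⟨c₃, hc₃γ, hwγ⟩ := thm4_windows_γ hd1 hL1 hB₀ hB₀' hB
  refine ⟨min (min c₁ c₂) c₃, lt_min (lt_min hc₁ hc₂) hc₃γ, ?_⟩
  intro η hη k Ω hΩ Λs Λb hbox hclass hlay α₀ α₁ hα₀ hα₁ hS U₀ U' hU₀ hU' h33 h34 hAx h135 h66 P5base P5 H59
  have hS1 : α₀ + α₁ ≤ c₁ := hS.trans ((min_le_left _ _).trans (min_le_left _ _))
  have hS2 : α₀ + α₁ ≤ c₂ := hS.trans ((min_le_left _ _).trans (min_le_right _ _))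
  have hS3 : α₀ + α₁ ≤ c₃ := hS.trans (min_le_right _ _)
  have hS0 : 0 ≤ α₀ + α₁ := by linarith
  obtain ⟨w1, w2, w3, w4, w5, w6, w7, w8, w9, w10, w11, w12, w13, w14, w15, w16, w17, w18⟩ :=
    hw α₀ α₁ hα₀ hα₁ hS1 (5 * (d : ℝ) * L * B₀ * (α₀ + α₁)) (8 * B₀' * (5 * (d : ℝ) * L * B₀) * (α₀ + α₁)) rfl rfl
  obtain ⟨w19, w20⟩ := hw' α₀ α₁ hα₀ hα₁ hS2
  obtain ⟨g5, g6, g7, g9, g10, g13, g14⟩ :=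
    hwγ α₀ α₁ hα₀ hα₁ hS3 (5 * (d : ℝ) * L * B₀ * (α₀ + α₁)) (8 * B₀' * (5 * (d : ℝ) * L * B₀) * (α₀ + α₁)) rfl rfl
  have hcs0 : 0 ≤ 5 * (d : ℝ) * L * B₀ * (α₀ + α₁) := by positivity
  have hα₄0 : 0 ≤ 8 * B₀' * (5 * (d : ℝ) * L * B₀) * (α₀ + α₁) := by positivity
  -- the exterior-collar window at the datum's (1.66)₀ level `a := α₁`
  have hbdry : 4 * Bbd * α₁ ≤ ((d : ℝ) * L - 1) * B₀ * (α₀ + α₁) := by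
    have h1 : 4 * Bbd * α₁ ≤ ((d : ℝ) * L - 1) * B₀ * α₁ := mul_le_mul_of_nonneg_right hBd hα₁.le
    have h2 : 0 ≤ ((d : ℝ) * L - 1) * B₀ := le_trans (by positivity) hBd
    have h3 : ((d : ℝ) * L - 1) * B₀ * α₁ ≤ ((d : ℝ) * L - 1) * B₀ * (α₀ + α₁) :=
      mul_le_mul_of_nonneg_left (le_add_of_nonneg_left hα₀.le) h2
    exact h1.trans h3
  -- EXISTENCE (support form) at the top level `k`, edition γ engine, sockets AT THE DATUM passed through
  obtain ⟨u, hu, huS, h129, W, hW, hLan, A, hA⟩ := thm4_exists_all_levels_supp_landau138_γ hd2 hη hL k hU₀ hU'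
    hα₀ hα₁ hα₄0 hB₀.le rfl w1 w2 w3 w4 g5 g6 g7 w7 w8 g9 g10 w11 w12 w19 hBbd hα₁.le hbdry g13 g14 Ω hΩ Λs Λb hbox hclass h33 h34 hAx
    h135 h66 hlay (le_mul_of_one_le_left hα₁.le (one_le_mul_of_one_le_of_one_le hd' hL')) P5base P5 H59 k le_rfl
  have hWeq : W = mgauge U₀ u⁻¹ U' := eq_mgauge_inv_of_mgauge_eq hW
  have hWu : ∀ x κ, W x κ ∈ unitaryUnits 𝔸 := mem_unitaryUnits_of_mgauge_eq hU₀ hU' hu hW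
  -- `c⋆ ≤ 1/16` for the logarithm device
  have hc16 : 5 * (d : ℝ) * L * B₀ * (α₀ + α₁) ≤ 1 / 16 := by
    have h₁ : (1 : ℝ) * (5 * (d : ℝ) * L * B₀ * (α₀ + α₁)) ≤ L * (5 * (d : ℝ) * L * B₀ * (α₀ + α₁)) :=
      mul_le_mul_of_nonneg_right hL' hcs0
    linarith
  -- the exponent read back as `logCfg`
  have hleaf : ∀ j, j ≤ k → ∀ b ∈ {b : Site d × Fin d | SideTouches (Ω j) b.1 b.2},
      mgauge U₀ u⁻¹ U' b.1 b.2 = cfgExp η (logCfg η (mgauge U₀ u⁻¹ U')) b.1 b.2 ∧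
        IsSelfAdjoint (logCfg η (mgauge U₀ u⁻¹ U') b.1 b.2) ∧
        ‖logCfg η (mgauge U₀ u⁻¹ U') b.1 b.2‖ ≤ (5 * (d : ℝ) * L * B₀ * (α₀ + α₁)) * ((L : ℝ) ^ j * η)⁻¹ := by
    intro j hj b hb
    obtain ⟨hexp, -, hbd⟩ := hA j hj b hb
    have hbd' : ‖A b.1 b.2‖ ≤ (5 * (d : ℝ) * L * B₀ * (α₀ + α₁)) * η⁻¹ := by
      refine hbd.trans ?_
      have hLj : (1 : ℝ) ≤ (L : ℝ) ^ j := one_le_pow₀ hL'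
      have : ((L : ℝ) ^ j * η)⁻¹ ≤ η⁻¹ := by
        rw [mul_inv]
        calc ((L : ℝ) ^ j)⁻¹ * η⁻¹ ≤ 1 * η⁻¹ := by gcongr; exact inv_le_one_of_one_le₀ hLj
          _ = η⁻¹ := one_mul _
      exact mul_le_mul_of_nonneg_left this hcs0
    obtain ⟨hlogA, hsa, hWexp⟩ := logField_spec hη U₀ hWu hexp hbd' hc16
    rw [← hWeq]
    refine ⟨hWexp, ?_, ?_⟩
    · simpa [logCfg] using hsa
    · show ‖logCfg η W b.1 b.2‖ ≤ _
      rw [logCfg, hlogA]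
      exact hbd
  exact ⟨u, hu, huS, h129, fun hk => hWeq ▸ hLan hk, hleaf⟩

#print axioms thm4Exists_concrete_at_γ

end Literature.MathematicalPhysics.QuantumFieldTheory.Balaban1983to89.B8Thm4ExistsAtGamma

end
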